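import Summits.BirchSwinnertonDyer.BirchSwinnertonDyer.Theorems.GenusKolyvaginAtTwoPowDvdShaCardAtTwoRTOrderFourAuxiliaryDeep
import Summits.BirchSwinnertonDyer.BirchSwinnertonDyer.Theorems.GenusKolyvaginAtTwoPowDvdShaCardAtTwoRTBottomRungNewPrime
import Summits.BirchSwinnertonDyer.BirchSwinnertonDyer.Theorems.GenusKolyvaginAtTwoPowDvdShaCardAtTwoRTBottomRungLocalInputs
import Summits.BirchSwinnertonDyer.BirchSwinnertonDyer.Theorems.GenusKolyvaginAtTwoPowDvdShaCardAtTwoRTBottomRungKummerLagrangian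
import Summits.BirchSwinnertonDyer.BirchSwinnertonDyer.Theorems.GenusKolyvaginAtTwoPowDvdShaCardAtTwoRTRelaxedDoublingKummer
import Summits.BirchSwinnertonDyer.BirchSwinnertonDyer.Theorems.GenusKolyvaginAtTwoEquivariantKolyvaginExactAtTwoPairBookkeeping
import Summits.BirchSwinnertonDyer.BirchSwinnertonDyer.Theorems.SchneiderFreeAdditiveX3PoitouTateSelmerComplementCanonical
import Literature.NumberTheory.EllipticCurves.HeegnerPointsKolyvaginPrimaryCebotarevProofs
import HarnessLib

/-!
# Route `GenusKolyvaginAtTwo`, crux L_T `PowDvdShaCardAtTwoRT` (stmt-BirchSwinnertonDyer-23242), LINE 18 stub L, bottom rung: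
# THE ONE-STEP ENGINE, ASSEMBLED — a `k`-minimal primitive product with a FREE own prime is impossible, MODULO NAMED `K`-SIDE INPUTS

LEAD seat `bsd-line-gk2-p1` g16 (cell `bsd-f1-sign2`), `--supports 23242 --as helper`.  THEOREMS ONLY; no `sorry`; standard axioms.
BSD is NOT proved by any of this; neither is the crux nor stub L.

WHY (memo `Cruxes/PowDvdShaCardAtTwoRT/Lines/plus-descent-lead-g16.md` §2).  Bottom rung of stub L for an index-≥2 witness: if the
`k`-minimal primitive product `n` has a free own prime (`s ≠ ∅`), pick the auxiliary `y` (gk2-p4 `DeepOwnPrime.exists_auxiliary_bottomRung`: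
Kummer off `s ∪ t`, `2y ≠ 0`, orthogonal at the deep own primes `t` to every `2•Z` transverse there), then a Čebotarev prime `ℓ′` for
`(c(n), res_K y)` and `Z = desc c(nℓ′)`; the `X = 2Z` reciprocity makes the `ℓ′`-term vanish, while Q2 + the order clauses make it non-zero
(`…RTBottomRungNewPrime`, `…RTBottomRungLocalInputs`, `…RTBottomRungKummerLagrangian`, `…RTRelaxedDoublingKummer`).  THIS FILE is the
composition, for the canonical Poitou–Tate family (`sumLocalTermEqZero_canonical`, `canonical_isPerfect`) and the tree's Weil pairing
(`exists_weilPairing_holds`), with every arithmetic input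
DISPLAYED as a hypothesis on `K`-side classes — exactly the list the final closer must discharge by name:
(Q2) `KolyvaginRelationAtTwo` at `λ′ ∣ ℓ′` (both clauses) and its second clause at each free `λ ∣ ℓ ∈ s`; (Čeb) the order clauses of
`EquivariantChebotarevAtTwoR` for `c(n)` and `res_K y` at `λ′` with exponent `2`; (M) imprimitivity `2 • c((n/ℓ)ℓ′) = 0` for `ℓ ∈ s`;
(Kum) `c(nℓ′)` Kummer at every place of `K` prime to `nℓ′`; (desc) `res_K Z = c(nℓ′)`; (tr) `2•Z` transverse at the deep own primes `t`
(gk2-p3); plus the Gross–Kolyvagin data of the primes.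
* **`false_of_bottomRung_engine`** — even depth (`Z ∈ H¹(ℚ, E[4])`); the odd-depth twin is the same statement for `Wd` with the `K`-side
  memberships moved through `hPsiKT` (`…PropFourFourRat`), not restated here.
Namespace `…Theorems.GenusExact.RelaxedCount`.  Closes nothing.  BSD is NOT proved by any of this.

References: [McCallumLMS1991] §4 Prop. 4.4, §5 Lemma 5.3 and proof of Prop. 5.2; [GrossLMS1991] Prop. 6.2, §9; [MilneADT2006] I Thm. 4.10.
-/

set_option autoImplicit false
-- the Theorems namespace of this sub repeats the summit name by design (D-0017 nested layout)
set_option linter.dupNamespace false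

noncomputable section

open scoped Classical

open Field NumberField IsDedekindDomain Function WeierstrassCurve
open Literature.NumberTheory.EllipticCurves
open Literature.NumberTheory.GaloisRepresentations
open Literature.NumberTheory.GaloisCohomology
open Summit.BirchSwinnertonDyer.Rank1Residual.X11b.FiniteDuality
open Summit.BirchSwinnertonDyer.Rank1Residual.X11b.Relaxation
open Summit.BirchSwinnertonDyer.BirchSwinnertonDyer.Theorems.GenusExact.SelmerDescent
open Summit.BirchSwinnertonDyer.BirchSwinnertonDyer.Theorems.GenusExact.DeepOwnPrime
open Summit.BirchSwinnertonDyer.BirchSwinnertonDyer.Theorems.SchneiderFreeAdditiveX3.PoitouTateReduction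

namespace Summit.BirchSwinnertonDyer.BirchSwinnertonDyer.Theorems.GenusExact.RelaxedCount

variable (W : WeierstrassCurve ℚ) [W.IsElliptic] [W.IsGloballyMinimal]

/-- **The one-step engine of the bottom rung (index `≥ 2`, even depth), modulo named inputs.**  `E/ℚ` globally minimal, `Δ < 0`, `ρ̄_{E,2}`
onto; `K = ℚ(θ)`, `θ² = c`, imaginary quadratic; `s ≠ ∅` (free) and `t` (deep) disjoint sets of places of Gross–Kolyvagin primes of index `≥ 2`
(`Frob = Frob_∞` on `E[4]` on `t`).  Suppose that for EVERY auxiliary `y ∈ H¹_{𝓛,⊤ on s∪t}(ℚ, E[4])` with `2y ≠ 0` one can find (as the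
Kolyvagin machine does: Čebotarev prime `ℓ′` for `(c(n), res_K y)`, `Z = desc c(nℓ′)`): a new Gross–Kolyvagin prime `ℓ′ ∉ s ∪ t`, `ℓ′ ∤ 2c`,
inert `λ′ ∣ ℓ′`, of index `≥ 2` with `Frob = Frob_∞` on `E[4]`; classes `Z ∈ H¹(ℚ, E[4])`, `c_K = c(n)`, `c_K′ = c(nℓ′)` with `res_K Z = c_K′`;
(Kum) `c_K′` Kummer at the places of `K` over every `v ∉ s ∪ t ∪ {ℓ′}`; (Q2) at `λ′`; (Čeb) order clauses with exponent `2` for `c_K` and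
`res_K y` at `λ′`; for each free `ℓ ∈ s`: inert `λ ∣ ℓ`, `ℓ ∤ c`, `Frob = Frob_∞` on `E[4]`, a class `c_K^{(ℓ)} = c((n/ℓ)ℓ′)` with Q2's second
clause at `λ` (`j = 1`) and (M) `2 • c_K^{(ℓ)} = 0`; (tr) `2•Z` transverse at the places of `t`.  Then `False` — so the `k`-minimal
primitive product has NO free own prime (`k = 0`): the bottom rung closes. [cite: McCallumLMS1991, §5 proof of Prop. 5.2]
[cite: GrossLMS1991, Prop. 6.2 and §9] [cite: MilneADT2006, Ch. I, Thm. 4.10] -/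
theorem false_of_bottomRung_engine (hΔ : W.Δ < 0) (hρ2 : W.HasSurjectiveModNGaloisRep 2)
    {K : Type} [Field K] [NumberField K] (hK : IsImaginaryQuadratic K) {θ : K} (hθ : θ ∉ (algebraMap ℚ K).range) {c : ℤ}
    (hc : θ ^ 2 = algebraMap ℚ K c)
    (s t : Finset (Place ℚ)) (hst : Disjoint s t) (hs : s.Nonempty)
    (hTK : ∀ u ∈ s ∪ t, ∃ (v : HeightOneSpectrum (𝓞 ℚ)) (ℓ : ℕ) (_ : Fact ℓ.Prime), u = Sum.inr v ∧ ℓ ≠ 2 ∧ (ℓ : 𝓞 ℚ) ∈ v.asIdeal ∧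
      W.HasGoodReductionAtPrime ℓ ∧ FrobEqFrobInfty W K 2 ℓ ∧ 2 ≤ Zhang2014.kolyvaginIndex W 2 ℓ)
    (ht4 : ∀ (v : HeightOneSpectrum (𝓞 ℚ)) (ℓ : ℕ), ℓ.Prime → Sum.inr v ∈ t → (ℓ : 𝓞 ℚ) ∈ v.asIdeal →
      FrobEqFrobInfty W K (2 ^ 2) ℓ)
    (hstep : ∀ y ∈ kummerOutside W (2 ^ 2) (s ∪ t), 2 • y ≠ 0 →
      ∃ (v' : HeightOneSpectrum (𝓞 ℚ)) (ℓ' : ℕ) (_ : Fact ℓ'.Prime) (w' : HeightOneSpectrum (𝓞 K))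
        (_ : w'.asIdeal.LiesOver v'.asIdeal) (Z : galoisCohomology (W.torsionGaloisModule ((2 ^ 2 : ℕ) : ℤ)) 1)
        (cK cK' : galH1Torsion (W.baseChange K) ((2 ^ 2 : ℕ) : ℤ)),
        (Sum.inr v' : Place ℚ) ∉ s ∪ t ∧ ℓ' ≠ 2 ∧ (ℓ' : 𝓞 ℚ) ∈ v'.asIdeal ∧ W.HasGoodReductionAtPrime ℓ' ∧
        ((c : ℤ) : 𝓞 ℚ) ∉ v'.asIdeal ∧ FrobEqFrobInfty W K (2 ^ 2) ℓ' ∧ 2 ≤ Zhang2014.kolyvaginIndex W 2 ℓ' ∧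
        w'.asIdeal.inertiaDeg (𝓞 ℚ) = 2 ∧
        resTorsion W K ((2 ^ 2 : ℕ) : ℤ) Z = cK' ∧
        (∀ v : HeightOneSpectrum (𝓞 ℚ), (Sum.inr v : Place ℚ) ∉ insert (Sum.inr v' : Place ℚ) (s ∪ t) →
          ∀ w : HeightOneSpectrum (𝓞 K), w.asIdeal.LiesOver v.asIdeal →
            cK' ∈ selmerLocalKer (W.baseChange K) (w.adicCompletion K) ((2 ^ 2 : ℕ) : ℤ)) ∧
        (∀ j : ℕ,
          (((2 ^ j : ℕ) : ℤ) • cK' ∈ selmerLocalKer (W.baseChange K) (w'.adicCompletion K) ((2 ^ 2 : ℕ) : ℤ) ↔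
            ((2 ^ j : ℕ) : ℤ) • cK' ∈ (W.baseChange K).torsionLocalKer (w'.adicCompletion K) ((2 ^ 2 : ℕ) : ℤ)) ∧
          (((2 ^ j : ℕ) : ℤ) • cK' ∈ (W.baseChange K).torsionLocalKer (w'.adicCompletion K) ((2 ^ 2 : ℕ) : ℤ) ↔
            ((2 ^ j : ℕ) : ℤ) • cK ∈ (W.baseChange K).torsionLocalKer (w'.adicCompletion K) ((2 ^ 2 : ℕ) : ℤ))) ∧
        (∀ j : ℕ, ((2 ^ j : ℕ) : ℤ) • cK ∈ (W.baseChange K).torsionLocalKer (w'.adicCompletion K) ((2 ^ 2 : ℕ) : ℤ) ↔ 2 ≤ j) ∧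
        (∀ j : ℕ, ((2 ^ j : ℕ) : ℤ) • resTorsion W K ((2 ^ 2 : ℕ) : ℤ) y ∈
          (W.baseChange K).torsionLocalKer (w'.adicCompletion K) ((2 ^ 2 : ℕ) : ℤ) ↔ 2 ≤ j) ∧
        (∀ u ∈ s, ∃ (v : HeightOneSpectrum (𝓞 ℚ)) (ℓ : ℕ) (w : HeightOneSpectrum (𝓞 K)) (_ : w.asIdeal.LiesOver v.asIdeal)
          (cKu : galH1Torsion (W.baseChange K) ((2 ^ 2 : ℕ) : ℤ)),
          u = Sum.inr v ∧ ℓ.Prime ∧ (ℓ : 𝓞 ℚ) ∈ v.asIdeal ∧ ((c : ℤ) : 𝓞 ℚ) ∉ v.asIdeal ∧ FrobEqFrobInfty W K (2 ^ 2) ℓ ∧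
          w.asIdeal.inertiaDeg (𝓞 ℚ) = 2 ∧
          (((2 ^ 1 : ℕ) : ℤ) • cK' ∈ (W.baseChange K).torsionLocalKer (w.adicCompletion K) ((2 ^ 2 : ℕ) : ℤ) ↔
            ((2 ^ 1 : ℕ) : ℤ) • cKu ∈ (W.baseChange K).torsionLocalKer (w.adicCompletion K) ((2 ^ 2 : ℕ) : ℤ)) ∧
          (2 : ℤ) • cKu = 0) ∧
        (∀ v : HeightOneSpectrum (𝓞 ℚ), Sum.inr v ∈ t →
          ∀ 𝔓 ∈ v.primesAbove, ∀ F c₀ : absoluteGaloisGroup ℚ, IsArithFrobAt (𝓞 ℚ) F 𝔓 →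
            IsComplexConjugation (Rat.castHom ℝ) c₀ → (∀ P : geomTorsion W ((2 ^ 2 : ℕ) : ℤ), F • P = c₀ • P) →
            ∃ P₁ : geomTorsion W ((2 ^ 2 : ℕ) : ℤ), h1Eval W _ ((2 : ℕ) • Z) F = F • P₁ - P₁)) :
    False := by
  haveI : NeZero (2 ^ 2) := ⟨by norm_num⟩
  have h2K : Module.finrank ℚ K = 2 := hK.1
  -- a Weil pairing at level `4` (tree theorem) and the canonical Poitou–Tate family
  obtain ⟨e, hμ, hadd₁, hadd₂, halt, hnondeg, hgal⟩ := W.exists_weilPairing_holds (2 ^ 2) (by norm_num) (by norm_num)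
  set inv : LocalInvariants ℚ (2 ^ 2) := LocalInvariants.canonical ℚ (2 ^ 2) with hinvdef
  have hperf := LocalInvariants.canonical_isPerfect (K := ℚ) (n := 2 ^ 2)
  -- the auxiliary class and the reciprocity it feeds
  obtain ⟨y, hyKO, hy2, hrec⟩ := exists_auxiliary_bottomRung W e hμ hadd₁ hadd₂ hgal halt hnondeg inv hΔ hρ2 s t hst hs hTK ht4
    (fun v _ ↦ (hperf v).1.1) (sumLocalTermEqZero_canonical (K := ℚ) (2 ^ 2))
  -- the step data for this `y`
  obtain ⟨v', ℓ', hℓ'p, w', hw', Z, cK, cK', hv'out, hℓ'2, hℓ'v, hgood', hcv', hFrob4', hidx', hf', hZ, hKum, hRel, hOrdZ, hOrdY,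
    hfree, htr⟩ := hstep y hyKO hy2
  have hgoodv' : W.HasGoodReductionAt v' := VisiblePairAtTwo.hasGoodReductionAt_of_hasGoodReductionAtPrime W hgood' hℓ'v
  have hFrob2' : FrobEqFrobInfty W K 2 ℓ' := hFrob4'.of_dvd ⟨2, by norm_num⟩
  have h22 : (1 : ℕ) ≤ 2 := by norm_num
  -- (hX): `2•Z` Kummer off `s ∪ t ∪ {ℓ′}`
  have hX : (2 : ℕ) • Z ∈ kummerOutside W (2 ^ 2) (insert (Sum.inr v' : Place ℚ) (s ∪ t)) :=
    two_nsmul_mem_kummerOutside_of_isImaginaryQuadratic W K hK (2 ^ 2) _ Z fun v hv w hw ↦ by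
      haveI := hw
      rw [hZ]
      exact hKum v hv w hw
  -- (hXs): `loc_u (2•Z) = 0` at the free primes
  have hXs : ∀ u ∈ s, galoisCohomology.localization (W.torsionGaloisModule ((2 ^ 2 : ℕ) : ℤ)) u 1 ((2 : ℕ) • Z) = 0 := by
    intro u hu
    obtain ⟨v, ℓ, w, hw, cKu, huv, hℓp, hℓv, hcv, hFrob4, hf, hRel₁, hcKu⟩ := hfree u hu
    obtain ⟨v₀, ℓ₀, hℓ₀p, huv₀, hℓ₀2, hℓ₀v, hgood₀, -, -⟩ := hTK u (Finset.mem_union_left t hu)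
    subst huv
    have hvv : v = v₀ := Sum.inr_injective huv₀
    subst hvv
    haveI := hw
    -- `ℓ = ℓ₀`: both lie in `v`
    have hℓℓ : ℓ = ℓ₀ := by
      have h1 := VisiblePairAtTwo.natGenerator_eq_of_natCast_prime_mem hℓp hℓv
      have h2 := VisiblePairAtTwo.natGenerator_eq_of_natCast_prime_mem hℓ₀p.out hℓ₀v
      exact h1.symm.trans h2
    subst hℓℓ
    have hgoodv : W.HasGoodReductionAt v := VisiblePairAtTwo.hasGoodReductionAt_of_hasGoodReductionAtPrime W hgood₀ hℓv
    exact localization_two_nsmul_eq_zero_of_K W hΔ h22 (q := 2 ^ 2) rfl hℓp hℓ₀2 hℓv hgoodv h2K hθ hc hcv hFrob4 w hf hZ hRel₁ hcKu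
  -- the `ℓ′`-term vanishes …
  have hzero := hrec (Sum.inr v') hv'out Z hX hXs htr
  -- … and does not vanish
  have hyK : y ∈ selmerLocalKer W (v'.adicCompletion ℚ) ((2 ^ 2 : ℕ) : ℤ) :=
    (res_mem_kummerLocalConditionAt_iff W ((2 ^ 2 : ℕ) : ℤ) (Place.Completion (Sum.inr v' : Place ℚ)) y).mp
      ((mem_kummerOutside_iff W (2 ^ 2) (s ∪ t) y).mp hyKO _ hv'out)
  have hOrdYℚ : ∀ j : ℕ, ((2 ^ j : ℕ) : ℤ) • y ∈ W.torsionLocalKer (v'.adicCompletion ℚ) ((2 ^ 2 : ℕ) : ℤ) ↔ 2 ≤ j := fun j ↦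
    (zsmul_mem_torsionLocalKer_iff_resTorsion_of_notMem W hΔ h22 (q := 2 ^ 2) rfl hℓ'p.out hℓ'2 hℓ'v hgoodv' h2K hθ hc hcv'
      hFrob4' w' hf' y _).trans (hOrdY j)
  obtain ⟨hmeet, hz'⟩ := bottomRung_newPrime_inputs_of_K W hΔ h22 (q := 2 ^ 2) rfl hℓ'p.out hℓ'2 hℓ'v hgoodv' h2K hθ hc hcv'
    hFrob4' w' hf' hZ hRel hOrdZ
  have hz : (2 : ℤ) • galoisCohomology.localization (W.torsionGaloisModule ((2 ^ 2 : ℕ) : ℤ)) (Sum.inr v') 1 Z ≠ 0 := by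
    have h21 : ((2 ^ (2 - 1) : ℕ) : ℤ) = 2 := by norm_num
    rwa [h21] at hz'
  have hF := annLeft_invWeilPairing_kummerSelmerStructure_le_canonical W e hμ hadd₁ hadd₂ hgal halt hnondeg (p := 2) (k := 2)
    two_ne_zero v' (LocalDualityOrder.two_notMem_of_odd_prime_mem hℓ'2 hℓ'v)
  exact invWeilPairing_localization_ne_zero_of_newPrime W (2 ^ 2) e hμ hadd₁ hadd₂ hgal hΔ hℓ'2 hgood' hFrob2' hℓ'v h22 hidx' rfl
    inv hF hyK hOrdYℚ hmeet hz hzero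

end Summit.BirchSwinnertonDyer.BirchSwinnertonDyer.Theorems.GenusExact.RelaxedCount

end
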